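import Summits.NavierStokesRegularity.FunctionalMining.StrainBlockWindow
import HarnessLib

/-!
# FunctionalMining — the bottom and middle eigenvalues of `tK + E` near the double top of `K`:
# the secular bound for `λ₃`, and Lemma 10 (c) for `λ₂` and for the top gap (F1 PART I, Lemma 10)

Search for candidate a priori estimates; no regularity claim. Cell `pub-nsfunc`, prove seat
(gen 22). Continuation of `StrainBlockWindow.lean` (Lemma 10 (a), (c) for `λ₁`). Same setting:
`S = tK + E` in the frame `(n^⊥, n)` through its Rayleigh form
`fᵀSf = tm(f₀² + f₁² − 2f₂²) + (B₀₀f₀² + 2B₀₁f₀f₁ + B₁₁f₁²) + 2f₂(b₀f₀ + b₁f₁) + e_nn f₂²`, the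
`E`-form bounded by `±ε|f|²`, `2ε < 3tm`; `λ₁ = lam1`, `λ₃ = lamMin` (`SharpClass.DirectorForm`), and —
as in the dictionary's `torusStrainMidEig` — the binder-free middle value
`λ₂ := tr S − λ₁ − λ₃ = (B₀₀ + B₁₁ + e_nn) − λ₁(S) − λ_min(S)`.

* `BlockReduction.lamMin_mul_le_ray` — `λ_min(M)|f|² ≤ fᵀMf`;
* `BlockReduction.lamMin_window` (Lemma 10 (a) for `λ₃`): `−2tm − ε ≤ λ₃ ≤ −2tm + ε`;
* **`BlockReduction.bottom_secular_lower` / `bottom_secular_upper`** (the secular equation of the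
  BOTTOM eigenvalue in inverse-free two-sided form): with `D₃ := e_nn − 2tm − λ₃ (= bᵀ(tm − λ₃ + B)⁻¹b)`,
  `|b|² ≤ D₃ (tm − λ₃ + ε)` and `D₃ (tm − λ₃ − ε) ≤ |b|²`; hence
  **`BlockReduction.abs_bottom_sub_le`**: `|λ₃ − (e_nn − 2tm − |b|²/(3tm))| ≤ |b|²·2ε/(3tm(3tm − 2ε))`;
* `BlockReduction.lam1_add_lamMin_fin2` — for a `2 × 2` Rayleigh form `aw₀² + 2bw₀w₁ + cw₁²`:
  `λ₁ + λ_min = a + c` (rotate the optimiser by `90°`);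
* **`BlockReduction.abs_lamMid_sub_reduced_le`** (LEMMA 10 (c) for `λ₂`):
  `|λ₂ − tm − λ_min(M̄)| ≤ (ε² + |b|²)·2ε/(3tm(3tm − 2ε)) ≤ 2R*`, `M̄ = B + b⊗b/(3tm)`;
* **`BlockReduction.abs_gap_sub_reduced_gap_le`** (the TOP GAP): `|(λ₁ − λ₂) − (λ₁(M̄) − λ_min(M̄))| ≤
  (2ε² + |b|²)·2ε/(3tm(3tm − 2ε)) ≤ 3R*` — "the top gap is the gap of `B` corrected by the rank-one tilt
  term `b⊗b/(3tm)`, up to `O(ε³/(tm)²)`" (the pen proof has `2R*`; the route here goes through `λ₃`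
  and the trace instead of the reduced problem at the level `λ₂`, at the price of one more `R*`).

Elementary: Rayleigh bounds, attainment of `λ_min`, completing squares. [ours; folklore]
-/

noncomputable section

open Matrix

namespace Summit.NavierStokesRegularity.FunctionalMining

open SharpClass.DirectorForm

namespace BlockReduction

/-! ## 0. Rayleigh tools for the bottom value -/

/-- `λ_min(M)|f|² ≤ fᵀ M f` for every vector. [folklore] -/
theorem lamMin_mul_le_ray {d : Type*} [Fintype d] (M : Matrix d d ℝ) (f : d → ℝ) :
    lamMin M * (f ⬝ᵥ f) ≤ f ⬝ᵥ M *ᵥ f := by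
  have h := ray_le_lam1_mul (-M) f
  rw [Matrix.neg_mulVec, dotProduct_neg] at h
  unfold lamMin
  linarith

/-- **`λ₁ + λ_min = a + c` for a `2 × 2` Rayleigh form `aw₀² + 2bw₀w₁ + cw₁²`** (the rotated unit
vector `(−w₁, w₀)` has the complementary Rayleigh value). [folklore] -/
theorem lam1_add_lamMin_fin2 {M : Matrix (Fin 2) (Fin 2) ℝ} {a b c : ℝ}
    (hM : ∀ w : Fin 2 → ℝ, w ⬝ᵥ M *ᵥ w = a * w 0 ^ 2 + 2 * b * w 0 * w 1 + c * w 1 ^ 2) :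
    lam1 M + lamMin M = a + c := by
  have hrot : ∀ w : Fin 2 → ℝ, w ⬝ᵥ w = 1 →
      (![-w 1, w 0] : Fin 2 → ℝ) ⬝ᵥ ![-w 1, w 0] = 1 ∧
        (![-w 1, w 0] : Fin 2 → ℝ) ⬝ᵥ M *ᵥ ![-w 1, w 0] = a + c - w ⬝ᵥ M *ᵥ w := by
    intro w hw
    simp only [dotProduct, Fin.sum_univ_two, ← pow_two] at hw
    refine ⟨?_, ?_⟩
    · simp [dotProduct, Fin.sum_univ_two]
      linear_combination hw
    · rw [hM, hM]
      simp
      linear_combination (a + c) * hw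
  refine le_antisymm ?_ ?_
  · -- at a top vector `w`, the rotated vector bounds `λ_min` from above
    obtain ⟨w, hw, hwtop⟩ := exists_ray_eq_lam1 M
    obtain ⟨h1, h2⟩ := hrot w hw
    have h3 := lamMin_le_ray M h1
    rw [h2, hwtop] at h3
    linarith
  · obtain ⟨w, hw, hwbot⟩ := exists_ray_eq_lamMin M
    obtain ⟨h1, h2⟩ := hrot w hw
    have h3 := ray_le_lam1 M h1
    rw [h2, hwbot] at h3
    linarith

/-! ## 1. Lemma 10 (a) for `λ₃` and the secular bound for the bottom eigenvalue -/

variable {S : Matrix (Fin 3) (Fin 3) ℝ} {t m B00 B01 B11 b0 b1 enn ε : ℝ}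

/-- **WEYL WINDOW for `λ₃` (F1 PART I Lemma 10 (a)).** If `tm ≥ 0`, the `E`-form is `≥ −ε|f|²` and
`e_nn ≤ ε`, then `−2tm − ε ≤ λ_min(S) ≤ −2tm + ε`. [folklore; Weyl] -/
theorem lamMin_window
    (hS : ∀ f : Fin 3 → ℝ, f ⬝ᵥ S *ᵥ f = t * m * (f 0 ^ 2 + f 1 ^ 2 - 2 * f 2 ^ 2) +
      (B00 * f 0 ^ 2 + 2 * B01 * f 0 * f 1 + B11 * f 1 ^ 2) + 2 * f 2 * (b0 * f 0 + b1 * f 1) + enn * f 2 ^ 2)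
    (htm : 0 ≤ t * m)
    (hElo : ∀ f : Fin 3 → ℝ, -(ε * (f 0 ^ 2 + f 1 ^ 2 + f 2 ^ 2)) ≤ (B00 * f 0 ^ 2 + 2 * B01 * f 0 * f 1 +
      B11 * f 1 ^ 2) + 2 * f 2 * (b0 * f 0 + b1 * f 1) + enn * f 2 ^ 2)
    (henn : enn ≤ ε) :
    -2 * (t * m) - ε ≤ lamMin S ∧ lamMin S ≤ -2 * (t * m) + ε := by
  constructor
  · refine le_lamMin fun f hf => ?_
    rw [hS f]
    simp only [dotProduct, Fin.sum_univ_three, ← pow_two] at hf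
    have h1 := hElo f
    rw [hf, mul_one] at h1
    nlinarith [h1, hf, sq_nonneg (f 0), sq_nonneg (f 1), htm]
  · -- test with `f = n`
    have h := lamMin_le_ray S (e := ![0, 0, 1]) (by simp [dotProduct, Fin.sum_univ_three])
    rw [hS] at h
    simp at h
    linarith

/-- **SECULAR BOUND FOR THE BOTTOM EIGENVALUE, lower half**: with `D₃ := e_nn − 2tm − λ_min(S)` and
`p₊ := tm − λ_min(S) + ε > 0`, if the `E`-form is `≤ ε|f|²` then `|b|² ≤ D₃ · p₊` (test the Rayleigh
quotient with `(−b, p₊)`; exact when `B = ε𝟙`). [ours; folklore — Schur complement] -/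
theorem bottom_secular_lower
    (hS : ∀ f : Fin 3 → ℝ, f ⬝ᵥ S *ᵥ f = t * m * (f 0 ^ 2 + f 1 ^ 2 - 2 * f 2 ^ 2) +
      (B00 * f 0 ^ 2 + 2 * B01 * f 0 * f 1 + B11 * f 1 ^ 2) + 2 * f 2 * (b0 * f 0 + b1 * f 1) + enn * f 2 ^ 2)
    (hEhi : ∀ f : Fin 3 → ℝ, (B00 * f 0 ^ 2 + 2 * B01 * f 0 * f 1 + B11 * f 1 ^ 2) +
      2 * f 2 * (b0 * f 0 + b1 * f 1) + enn * f 2 ^ 2 ≤ ε * (f 0 ^ 2 + f 1 ^ 2 + f 2 ^ 2))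
    (hp : 0 < t * m - lamMin S + ε) :
    b0 ^ 2 + b1 ^ 2 ≤ (enn - 2 * (t * m) - lamMin S) * (t * m - lamMin S + ε) := by
  set p := t * m - lamMin S + ε with hpdef
  set f : Fin 3 → ℝ := ![-b0, -b1, p] with hf
  have h1 := lamMin_mul_le_ray S f
  have hff : f ⬝ᵥ f = b0 ^ 2 + b1 ^ 2 + p ^ 2 := by
    simp only [hf, dotProduct, Fin.sum_univ_three, Matrix.cons_val_zero, Matrix.cons_val_one,
      Matrix.cons_val_two, Matrix.head_cons, Matrix.tail_cons]
    ring
  have hSf := hS f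
  simp only [hf, Matrix.cons_val_zero, Matrix.cons_val_one, Matrix.head_cons, Matrix.cons_val_two,
    Matrix.tail_cons] at hSf
  -- the `B`-form at `(b₀, b₁, 0)` is `≤ ε|b|²`
  have hB := hEhi ![b0, b1, 0]
  simp at hB
  rw [hff, hSf] at h1
  -- `λ₃(|b|² + p²) ≤ tm|b|² + Bform(b) − 2p|b|² + (e_nn − 2tm)p²`
  nlinarith [h1, hB, hp]

/-- **SECULAR BOUND FOR THE BOTTOM EIGENVALUE, upper half**: with `D₃ := e_nn − 2tm − λ_min(S)` and
`p₋ := tm − λ_min(S) − ε > 0`, if the `E`-form is `≥ −ε|f|²` then `D₃ · p₋ ≤ |b|²` (evaluate the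
Rayleigh form at a bottom vector and complete the square in `|w|`). [ours; folklore] -/
theorem bottom_secular_upper
    (hS : ∀ f : Fin 3 → ℝ, f ⬝ᵥ S *ᵥ f = t * m * (f 0 ^ 2 + f 1 ^ 2 - 2 * f 2 ^ 2) +
      (B00 * f 0 ^ 2 + 2 * B01 * f 0 * f 1 + B11 * f 1 ^ 2) + 2 * f 2 * (b0 * f 0 + b1 * f 1) + enn * f 2 ^ 2)
    (hElo : ∀ f : Fin 3 → ℝ, -(ε * (f 0 ^ 2 + f 1 ^ 2 + f 2 ^ 2)) ≤ (B00 * f 0 ^ 2 + 2 * B01 * f 0 * f 1 +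
      B11 * f 1 ^ 2) + 2 * f 2 * (b0 * f 0 + b1 * f 1) + enn * f 2 ^ 2)
    (hp : 0 < t * m - lamMin S - ε) :
    (enn - 2 * (t * m) - lamMin S) * (t * m - lamMin S - ε) ≤ b0 ^ 2 + b1 ^ 2 := by
  set p := t * m - lamMin S - ε with hpdef
  set D := enn - 2 * (t * m) - lamMin S with hDdef
  obtain ⟨f, hf, hfS⟩ := exists_ray_eq_lamMin S
  rw [hS f] at hfS
  simp only [dotProduct, Fin.sum_univ_three, ← pow_two] at hf
  -- the `B`-form at `(f₀, f₁, 0)` is `≥ −ε(f₀² + f₁²)`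
  have hB := hElo ![f 0, f 1, 0]
  simp at hB
  -- `A := f₀² + f₁²`, `β := b₀f₀ + b₁f₁`, `s := f₂`:  `pA + 2sβ + D s² ≤ 0`
  have hstar : p * (f 0 ^ 2 + f 1 ^ 2) + 2 * f 2 * (b0 * f 0 + b1 * f 1) + D * f 2 ^ 2 ≤ 0 := by
    have hl : lamMin S * (f 0 ^ 2 + f 1 ^ 2 + f 2 ^ 2) = lamMin S := by rw [hf, mul_one]
    nlinarith [hfS, hB, hl]
  -- Cauchy–Schwarz `β² ≤ |b|² A`
  have hCS : (b0 * f 0 + b1 * f 1) ^ 2 ≤ (b0 ^ 2 + b1 ^ 2) * (f 0 ^ 2 + f 1 ^ 2) := by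
    nlinarith [sq_nonneg (b0 * f 1 - b1 * f 0)]
  -- `s ≠ 0`: otherwise `pA ≤ 0` with `A = 1`
  have hs : 0 < f 2 ^ 2 := by
    rcases (sq_nonneg (f 2)).eq_or_lt with h | h
    · exfalso
      have hA : f 0 ^ 2 + f 1 ^ 2 = 1 := by linarith
      have h0 : f 2 = 0 := by
        rcases sq_eq_zero_iff.1 h.symm with h'
        exact h'
      rw [h0, hA] at hstar
      simp at hstar
      linarith
    · exact h
  -- complete the square: `(pA + sβ)² ≥ 0` gives `2pA·sβ ≥ −p²A² − s²β² ≥ −p²A² − s²|b|²A`, while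
  -- `pA·(pA + 2sβ + Ds²) ≤ 0`; together `pA·D·s² ≤ s²|b|²A`
  rcases (show 0 ≤ f 0 ^ 2 + f 1 ^ 2 by positivity).eq_or_lt with hA0 | hApos
  · -- `w = 0`: then `β = 0` and `D ≤ 0 ≤ |b|²/p`
    have h0 : f 0 = 0 := by nlinarith [sq_nonneg (f 0), sq_nonneg (f 1)]
    have h1 : f 1 = 0 := by nlinarith [sq_nonneg (f 0), sq_nonneg (f 1)]
    rw [h0, h1] at hstar
    have hD : D ≤ 0 := by nlinarith [hstar, hs]
    nlinarith [hD, hp, sq_nonneg b0, sq_nonneg b1]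
  · have hpA : 0 < p * (f 0 ^ 2 + f 1 ^ 2) := mul_pos hp hApos
    have e1 : 0 ≤ (p * (f 0 ^ 2 + f 1 ^ 2) + f 2 * (b0 * f 0 + b1 * f 1)) ^ 2 := sq_nonneg _
    have e2 : p * (f 0 ^ 2 + f 1 ^ 2) * (p * (f 0 ^ 2 + f 1 ^ 2) + 2 * f 2 * (b0 * f 0 + b1 * f 1) +
        D * f 2 ^ 2) ≤ p * (f 0 ^ 2 + f 1 ^ 2) * 0 :=
      mul_le_mul_of_nonneg_left hstar hpA.le
    have e3 : f 2 ^ 2 * (b0 * f 0 + b1 * f 1) ^ 2 ≤ f 2 ^ 2 * ((b0 ^ 2 + b1 ^ 2) * (f 0 ^ 2 + f 1 ^ 2)) :=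
      mul_le_mul_of_nonneg_left hCS hs.le
    have e4 : (p * D - (b0 ^ 2 + b1 ^ 2)) * ((f 0 ^ 2 + f 1 ^ 2) * f 2 ^ 2) ≤ 0 := by
      nlinarith [e1, e2, e3]
    have hpos : 0 < (f 0 ^ 2 + f 1 ^ 2) * f 2 ^ 2 := mul_pos hApos hs
    rcases lt_or_ge 0 (p * D - (b0 ^ 2 + b1 ^ 2)) with hbad | hgood
    · exfalso
      have := mul_pos hbad hpos
      linarith
    · linarith

/-- **LEMMA 10 (c)-type bound for `λ₃`**: under the two-sided `E`-form bound, `e_nn ≤ ε` and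
`2ε < 3tm`: `|λ_min(S) − (e_nn − 2tm − |b|²/(3tm))| ≤ |b|² · 2ε/(3tm(3tm − 2ε))` — the bottom
eigenvalue is `e_nn − 2tm` corrected by the rank-one term `−|b|²/(3tm)`, up to `O(ε³/(tm)²)`. [ours] -/
theorem abs_bottom_sub_le
    (hS : ∀ f : Fin 3 → ℝ, f ⬝ᵥ S *ᵥ f = t * m * (f 0 ^ 2 + f 1 ^ 2 - 2 * f 2 ^ 2) +
      (B00 * f 0 ^ 2 + 2 * B01 * f 0 * f 1 + B11 * f 1 ^ 2) + 2 * f 2 * (b0 * f 0 + b1 * f 1) + enn * f 2 ^ 2)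
    (htm : 0 < t * m) (hε : 2 * ε < 3 * (t * m))
    (hEhi : ∀ f : Fin 3 → ℝ, (B00 * f 0 ^ 2 + 2 * B01 * f 0 * f 1 + B11 * f 1 ^ 2) +
      2 * f 2 * (b0 * f 0 + b1 * f 1) + enn * f 2 ^ 2 ≤ ε * (f 0 ^ 2 + f 1 ^ 2 + f 2 ^ 2))
    (hElo : ∀ f : Fin 3 → ℝ, -(ε * (f 0 ^ 2 + f 1 ^ 2 + f 2 ^ 2)) ≤ (B00 * f 0 ^ 2 + 2 * B01 * f 0 * f 1 +
      B11 * f 1 ^ 2) + 2 * f 2 * (b0 * f 0 + b1 * f 1) + enn * f 2 ^ 2)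
    (henn : enn ≤ ε) :
    |lamMin S - (enn - 2 * (t * m) - (b0 ^ 2 + b1 ^ 2) / (3 * (t * m)))| ≤
      (b0 ^ 2 + b1 ^ 2) * (2 * ε / (3 * (t * m) * (3 * (t * m) - 2 * ε))) := by
  have hε0 : 0 ≤ ε := by
    have h := hEhi ![0, 0, 1]
    have h' := hElo ![0, 0, 1]
    simp at h h'
    linarith
  obtain ⟨hlo, hhi⟩ := lamMin_window hS htm.le hElo henn
  have hp1 : 0 < t * m - lamMin S + ε := by linarith
  have hp2 : 0 < t * m - lamMin S - ε := by linarith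
  have hlow := bottom_secular_lower hS hEhi hp1
  have hupp := bottom_secular_upper hS hElo hp2
  set D := enn - 2 * (t * m) - lamMin S with hD
  set bb := b0 ^ 2 + b1 ^ 2 with hbb
  have hbb0 : 0 ≤ bb := by positivity
  have h3 : 0 < 3 * (t * m) := by linarith
  have hgap : 0 < 3 * (t * m) - 2 * ε := by linarith
  have htm0 : t * m ≠ 0 := htm.ne'
  have hgap0 : 3 * (t * m) - 2 * ε ≠ 0 := hgap.ne'
  -- `bb/(3tm + 2ε) ≤ D ≤ bb/(3tm − 2ε)`
  have hDlo : bb ≤ D * (3 * (t * m) + 2 * ε) := by nlinarith [hlow, hhi, hlo, hbb0]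
  have hDhi : D * (3 * (t * m) - 2 * ε) ≤ bb := by
    rcases le_or_gt D 0 with hD0 | hDpos
    · nlinarith [hD0, hgap, hbb0]
    · nlinarith [hupp, hlo, hDpos]
  rw [show lamMin S - (enn - 2 * (t * m) - bb / (3 * (t * m))) = bb / (3 * (t * m)) - D by
    rw [hD]; ring]
  rw [abs_le]
  constructor
  · -- `D − bb/(3tm) ≤ bb·2ε/(3tm(3tm−2ε))`
    have h1 : D ≤ bb / (3 * (t * m) - 2 * ε) := by rw [le_div_iff₀ hgap]; exact hDhi
    have h2 : bb / (3 * (t * m) - 2 * ε) - bb / (3 * (t * m)) =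
        bb * (2 * ε / (3 * (t * m) * (3 * (t * m) - 2 * ε))) := by
      rw [div_sub_div _ _ hgap0 h3.ne', ← mul_div_assoc]
      congr 1 <;> ring
    linarith
  · -- `bb/(3tm) − D ≤ bb·2ε/(3tm(3tm+2ε)) ≤ bb·2ε/(3tm(3tm−2ε))`
    have hplus : 0 < 3 * (t * m) + 2 * ε := by linarith
    have hplus0 : 3 * (t * m) + 2 * ε ≠ 0 := hplus.ne'
    have h1 : bb / (3 * (t * m) + 2 * ε) ≤ D := by rw [div_le_iff₀ hplus]; exact hDlo
    have h2 : bb / (3 * (t * m)) - bb / (3 * (t * m) + 2 * ε) =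
        bb * (2 * ε / (3 * (t * m) * (3 * (t * m) + 2 * ε))) := by
      rw [div_sub_div _ _ h3.ne' hplus0, ← mul_div_assoc]
      congr 1; ring
    have h4 : bb * (2 * ε / (3 * (t * m) * (3 * (t * m) + 2 * ε))) ≤
        bb * (2 * ε / (3 * (t * m) * (3 * (t * m) - 2 * ε))) := by
      refine mul_le_mul_of_nonneg_left ?_ hbb0
      refine div_le_div_of_nonneg_left (by linarith) (mul_pos h3 hgap) ?_
      nlinarith [h3, hε0]
    linarith

/-! ## 2. Lemma 10 (c) for the binder-free middle value `λ₂ = tr S − λ₁ − λ₃` and for the top gap -/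

/-- **LEMMA 10 (c) FOR `λ₂` (F1 PART I).** With `λ₂ := (B₀₀ + B₁₁ + e_nn) − λ₁(S) − λ_min(S)` (the
trace minus the extreme values) and `M̄` the frozen reduced matrix `B + b⊗b/(3tm)`:
`|λ₂ − tm − λ_min(M̄)| ≤ (ε² + |b|²) · 2ε/(3tm(3tm − 2ε)) ≤ 2R*`. [ours; F1 PART I Lemma 10 (c)] -/
theorem abs_lamMid_sub_reduced_le
    (hS : ∀ f : Fin 3 → ℝ, f ⬝ᵥ S *ᵥ f = t * m * (f 0 ^ 2 + f 1 ^ 2 - 2 * f 2 ^ 2) +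
      (B00 * f 0 ^ 2 + 2 * B01 * f 0 * f 1 + B11 * f 1 ^ 2) + 2 * f 2 * (b0 * f 0 + b1 * f 1) + enn * f 2 ^ 2)
    (htm : 0 < t * m) (hε : 2 * ε < 3 * (t * m))
    (hEhi : ∀ f : Fin 3 → ℝ, (B00 * f 0 ^ 2 + 2 * B01 * f 0 * f 1 + B11 * f 1 ^ 2) +
      2 * f 2 * (b0 * f 0 + b1 * f 1) + enn * f 2 ^ 2 ≤ ε * (f 0 ^ 2 + f 1 ^ 2 + f 2 ^ 2))
    (hElo : ∀ f : Fin 3 → ℝ, -(ε * (f 0 ^ 2 + f 1 ^ 2 + f 2 ^ 2)) ≤ (B00 * f 0 ^ 2 + 2 * B01 * f 0 * f 1 +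
      B11 * f 1 ^ 2) + 2 * f 2 * (b0 * f 0 + b1 * f 1) + enn * f 2 ^ 2)
    (hb : b0 ^ 2 + b1 ^ 2 ≤ ε ^ 2) {Mbar : Matrix (Fin 2) (Fin 2) ℝ}
    (hMbar : ∀ w : Fin 2 → ℝ, w ⬝ᵥ Mbar *ᵥ w = B00 * w 0 ^ 2 + 2 * B01 * w 0 * w 1 + B11 * w 1 ^ 2 +
      (b0 * w 0 + b1 * w 1) ^ 2 / (3 * (t * m))) :
    |(B00 + B11 + enn) - lam1 S - lamMin S - t * m - lamMin Mbar| ≤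
      (ε ^ 2 + (b0 ^ 2 + b1 ^ 2)) * (2 * ε / (3 * (t * m) * (3 * (t * m) - 2 * ε))) := by
  -- consequences of the two-sided form bound at basis vectors
  have hB00 : -ε ≤ B00 := by have h := hElo ![1, 0, 0]; simp at h; linarith
  have henn : |enn| ≤ ε := by
    have h := hEhi ![0, 0, 1]; have h' := hElo ![0, 0, 1]; simp at h h'
    exact abs_le.2 ⟨by linarith, by linarith⟩
  have htop := abs_lam1_sub_reduced_le hS htm hε hEhi hB00 henn hb hMbar
  have hbot := abs_bottom_sub_le hS htm hε hEhi hElo (abs_le.1 henn).2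
  -- `λ₁(M̄) + λ_min(M̄) = tr M̄ = B₀₀ + B₁₁ + |b|²/(3tm)`
  have htr : lam1 Mbar + lamMin Mbar = (B00 + b0 * b0 / (3 * (t * m))) + (B11 + b1 * b1 / (3 * (t * m))) :=
    lam1_add_lamMin_fin2 (b := B01 + b0 * b1 / (3 * (t * m))) fun w => by
      rw [hMbar w]
      ring
  have hkey : (B00 + B11 + enn) - lam1 S - lamMin S - t * m - lamMin Mbar =
      -(lam1 S - t * m - lam1 Mbar) -
        (lamMin S - (enn - 2 * (t * m) - (b0 ^ 2 + b1 ^ 2) / (3 * (t * m)))) := by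
    linear_combination -htr
  rw [hkey, add_mul]
  refine (abs_sub _ _).trans (add_le_add ?_ hbot)
  rw [abs_neg]
  exact htop

/-- **THE TOP GAP (F1 PART I Lemma 10 (c)).** With `λ₂ := (B₀₀ + B₁₁ + e_nn) − λ₁(S) − λ_min(S)` and
`γ̄ := λ₁(M̄) − λ_min(M̄)` the gap of the frozen reduced matrix `M̄ = B + b⊗b/(3tm)`:
`|(λ₁(S) − λ₂) − γ̄| ≤ (2ε² + |b|²) · 2ε/(3tm(3tm − 2ε)) ≤ 3R*` — the relevant gap for the rotation
channel is the gap of `B` CORRECTED BY THE TILT TERM `b⊗b/(3tm)`, not the gap of `B`, up to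
`O(ε³/(tm)²)`. [ours; F1 PART I Lemma 10 (c)] -/
theorem abs_gap_sub_reduced_gap_le
    (hS : ∀ f : Fin 3 → ℝ, f ⬝ᵥ S *ᵥ f = t * m * (f 0 ^ 2 + f 1 ^ 2 - 2 * f 2 ^ 2) +
      (B00 * f 0 ^ 2 + 2 * B01 * f 0 * f 1 + B11 * f 1 ^ 2) + 2 * f 2 * (b0 * f 0 + b1 * f 1) + enn * f 2 ^ 2)
    (htm : 0 < t * m) (hε : 2 * ε < 3 * (t * m))
    (hEhi : ∀ f : Fin 3 → ℝ, (B00 * f 0 ^ 2 + 2 * B01 * f 0 * f 1 + B11 * f 1 ^ 2) +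
      2 * f 2 * (b0 * f 0 + b1 * f 1) + enn * f 2 ^ 2 ≤ ε * (f 0 ^ 2 + f 1 ^ 2 + f 2 ^ 2))
    (hElo : ∀ f : Fin 3 → ℝ, -(ε * (f 0 ^ 2 + f 1 ^ 2 + f 2 ^ 2)) ≤ (B00 * f 0 ^ 2 + 2 * B01 * f 0 * f 1 +
      B11 * f 1 ^ 2) + 2 * f 2 * (b0 * f 0 + b1 * f 1) + enn * f 2 ^ 2)
    (hb : b0 ^ 2 + b1 ^ 2 ≤ ε ^ 2) {Mbar : Matrix (Fin 2) (Fin 2) ℝ}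
    (hMbar : ∀ w : Fin 2 → ℝ, w ⬝ᵥ Mbar *ᵥ w = B00 * w 0 ^ 2 + 2 * B01 * w 0 * w 1 + B11 * w 1 ^ 2 +
      (b0 * w 0 + b1 * w 1) ^ 2 / (3 * (t * m))) :
    |(lam1 S - ((B00 + B11 + enn) - lam1 S - lamMin S)) - (lam1 Mbar - lamMin Mbar)| ≤
      (2 * ε ^ 2 + (b0 ^ 2 + b1 ^ 2)) * (2 * ε / (3 * (t * m) * (3 * (t * m) - 2 * ε))) := by
  have hB00 : -ε ≤ B00 := by have h := hElo ![1, 0, 0]; simp at h; linarith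
  have henn : |enn| ≤ ε := by
    have h := hEhi ![0, 0, 1]; have h' := hElo ![0, 0, 1]; simp at h h'
    exact abs_le.2 ⟨by linarith, by linarith⟩
  have htop := abs_lam1_sub_reduced_le hS htm hε hEhi hB00 henn hb hMbar
  have hmid := abs_lamMid_sub_reduced_le hS htm hε hEhi hElo hb hMbar
  have hkey : (lam1 S - ((B00 + B11 + enn) - lam1 S - lamMin S)) - (lam1 Mbar - lamMin Mbar) =
      (lam1 S - t * m - lam1 Mbar) - ((B00 + B11 + enn) - lam1 S - lamMin S - t * m - lamMin Mbar) := by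
    ring
  rw [hkey, show (2 * ε ^ 2 + (b0 ^ 2 + b1 ^ 2)) * (2 * ε / (3 * (t * m) * (3 * (t * m) - 2 * ε))) =
      ε ^ 2 * (2 * ε / (3 * (t * m) * (3 * (t * m) - 2 * ε))) +
        (ε ^ 2 + (b0 ^ 2 + b1 ^ 2)) * (2 * ε / (3 * (t * m) * (3 * (t * m) - 2 * ε))) by ring]
  exact (abs_sub _ _).trans (add_le_add htop hmid)

end BlockReduction

end Summit.NavierStokesRegularity.FunctionalMining

end
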